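import Literature.AnabelianGeometry.SemiGraphs.PSCSeparatingCoveringsProofs2
import Literature.AnabelianGeometry.SemiGraphs.PSCGraphicConverseIncidence
import HarnessLib

/-!
# [CombGC] Proposition 1.5 (ii) from the separating coverings, Proposition 1.5 (i) and the branch link

Mochizuki, *A combinatorial version of the Grothendieck conjecture*, Tohoku Math. J. **59** (2007)
[CombGC], §1: Proposition 1.5 (ii) p. 13 ("`α` is graphic if and only if `α` is group-theoretically
verticial and group-theoretically edge-like … the isomorphism of semi-graphs is functorially
determined by `α`"), read through its proof's inputs Proposition 1.2 (i) p. 8 (proof p. 9: separating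
finite étale coverings) and Proposition 1.5 (i) p. 12.

End-to-end composite of the abc-iut cell's two CombGC sub-chains, BY NAME (no new statement, no new
hypothesis beyond those already displayed upstream):
* Prop. 1.2 (i) ⇐ `SeparatingCoverings` (rows P12-L01/L02 of `plan/L3/SUBDAG-CombGC-Prop12.md`:
  statements `PSCSeparatingCoverings.lean`, seat abc-iut-w4-d081; proofs
  `PSCSeparatingCoveringsProofs{,2}.lean`, seat abc-iut-w5-d183), and
* Prop. 1.5 (ii) ⇐ from Prop. 1.2 (i), Prop. 1.5 (i) and the distinct-branch-overgroups link
  (`PSCGraphicConverse{,Incidence}.lean`, seat abc-iut-w4-d081; the link is cell GAP-LEDGER row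
  G-w4d081-1, displayed),
so that the typed Prop. 1.5 (ii) (`GraphicIffEdgeLikeVerticial`, per pair of data, and
`GraphicIffEdgeLikeVerticialHolds Ω`, over the origin predicate) rests on exactly: the separating
coverings (verticial and edge-like clauses) for `G` and `H`, Prop. 1.5 (i) (`EdgeLikeIncidence`) for
`G` and `H`, the branch link for `G` and `H`, and profiniteness of `Π_G`, `Π_H`.

Pure composition; nothing here takes a side on [IUTchIII] Cor. 3.12.
-/

noncomputable section

namespace Literature.AnabelianGeometry.SemiGraphs

namespace PSCDatum

open scoped Pointwise

universe u

section PerDatum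

variable {P : Type u} [Group P] [TopologicalSpace P] [IsTopologicalGroup P] [CompactSpace P]
  [TotallyDisconnectedSpace P]
variable {P' : Type u} [Group P'] [TopologicalSpace P'] [IsTopologicalGroup P'] [CompactSpace P']
  [TotallyDisconnectedSpace P']
variable {G : PSCDatum P} {H : PSCDatum P'} {α : P ≃ₜ* P'}

/-- **[CombGC] Prop. 1.5 (ii), "⇐", from the separating coverings**: for profinite `Π_G`, `Π_H`,
granting the verticial and edge-like separating coverings (Prop. 1.2's proof) and Prop. 1.5 (i) for
`G` and for `H`, together with the branch link, a group-theoretically edge-like and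
group-theoretically verticial `α` is graphic. [cite: MochizukiCombGC2007, Prop 1.5(ii) p.13] -/
theorem isGraphic_of_separating_of_isGroupTheoreticallyEdgeLike_of_isGroupTheoreticallyVerticial
    (hVG : G.VerticialSeparatingCoverings) (hEG : G.EdgeLikeSeparatingCoverings)
    (hIG : G.EdgeLikeIncidence)
    (hbrG : ∀ e : G.graph.N, ∃ (v₁ v₂ : G.graph.V) (γ₁ γ₂ : ConjAct P),
      G.graph.nodeEnds e = s(v₁, v₂) ∧ γ₁ • G.nodeGp e ≤ G.vertGp v₁ ∧
        γ₂ • G.nodeGp e ≤ G.vertGp v₂ ∧ γ₁⁻¹ • G.vertGp v₁ ≠ γ₂⁻¹ • G.vertGp v₂)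
    (hVH : H.VerticialSeparatingCoverings) (hEH : H.EdgeLikeSeparatingCoverings)
    (hIH : H.EdgeLikeIncidence)
    (hbrH : ∀ e' : H.graph.N, ∃ (w₁ w₂ : H.graph.V) (γ₁ γ₂ : ConjAct P'),
      H.graph.nodeEnds e' = s(w₁, w₂) ∧ γ₁ • H.nodeGp e' ≤ H.vertGp w₁ ∧
        γ₂ • H.nodeGp e' ≤ H.vertGp w₂ ∧ γ₁⁻¹ • H.vertGp w₁ ≠ γ₂⁻¹ • H.vertGp w₂)
    (hel : G.IsGroupTheoreticallyEdgeLike H α) (hv : G.IsGroupTheoreticallyVerticial H α) :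
    G.IsGraphic H α :=
  isGraphic_of_isGroupTheoreticallyEdgeLike_of_isGroupTheoreticallyVerticial
    (G.verticialOpenInterDeterminesVertex_of_separating hVG)
    (G.edgeLikeOpenInterDeterminesEdge_of_separating hEG) hIG hbrG
    (H.verticialOpenInterDeterminesVertex_of_separating hVH)
    (H.edgeLikeOpenInterDeterminesEdge_of_separating hEH) hIH hbrH hel hv

/-- **[CombGC] Prop. 1.5 (ii) as typed per pair of data** (`GraphicIffEdgeLikeVerticial G H α`: the
equivalence and the uniqueness of the induced isomorphism of semi-graphs) from the separating
coverings, Prop. 1.5 (i) and the branch link for `G`, `H` (profinite `Π_G`, `Π_H`).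
[cite: MochizukiCombGC2007, Prop 1.5(ii) p.13] -/
theorem graphicIffEdgeLikeVerticial_of_separating
    (hVG : G.VerticialSeparatingCoverings) (hEG : G.EdgeLikeSeparatingCoverings)
    (hIG : G.EdgeLikeIncidence)
    (hbrG : ∀ e : G.graph.N, ∃ (v₁ v₂ : G.graph.V) (γ₁ γ₂ : ConjAct P),
      G.graph.nodeEnds e = s(v₁, v₂) ∧ γ₁ • G.nodeGp e ≤ G.vertGp v₁ ∧
        γ₂ • G.nodeGp e ≤ G.vertGp v₂ ∧ γ₁⁻¹ • G.vertGp v₁ ≠ γ₂⁻¹ • G.vertGp v₂)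
    (hVH : H.VerticialSeparatingCoverings) (hEH : H.EdgeLikeSeparatingCoverings)
    (hIH : H.EdgeLikeIncidence)
    (hbrH : ∀ e' : H.graph.N, ∃ (w₁ w₂ : H.graph.V) (γ₁ γ₂ : ConjAct P'),
      H.graph.nodeEnds e' = s(w₁, w₂) ∧ γ₁ • H.nodeGp e' ≤ H.vertGp w₁ ∧
        γ₂ • H.nodeGp e' ≤ H.vertGp w₂ ∧ γ₁⁻¹ • H.vertGp w₁ ≠ γ₂⁻¹ • H.vertGp w₂) :
    G.GraphicIffEdgeLikeVerticial H α :=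
  graphicIffEdgeLikeVerticial_of_incidence (G.verticialOpenInterDeterminesVertex_of_separating hVG)
    (G.edgeLikeOpenInterDeterminesEdge_of_separating hEG) hIG hbrG
    (H.verticialOpenInterDeterminesVertex_of_separating hVH)
    (H.edgeLikeOpenInterDeterminesEdge_of_separating hEH) hIH hbrH

end PerDatum

section Origin

/-- **[CombGC] Prop. 1.5 (ii) as printed over the origin predicate** (`GraphicIffEdgeLikeVerticialHolds Ω`)
from the ONE origin-level separating-coverings statement `SeparatingCoveringsHolds Ω` (Prop. 1.2's
proof, p. 9), Prop. 1.5 (i) as printed (`EdgeLikeIncidenceHolds Ω`), the branch link for `Ω`-data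
(displayed; cell GAP-LEDGER G-w4d081-1) and profiniteness of the PSC-fundamental groups of `Ω`-data
(Def. 1.1 (ii); displayed) — via `openInterDeterminesComponentHolds_of_separating` (abc-iut-w5-d183)
and `graphicIffEdgeLikeVerticialHolds_of_incidence`. [cite: MochizukiCombGC2007, Prop 1.5(ii) p.13] -/
theorem graphicIffEdgeLikeVerticialHolds_of_separating (Ω : PSCOrigin.{u})
    (hsep : SeparatingCoveringsHolds Ω)
    (hprof : ∀ ⦃Q : Type u⦄ [Group Q] [TopologicalSpace Q] [IsTopologicalGroup Q] (G : PSCDatum Q),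
      Ω.IsOfPSCType G → CompactSpace Q ∧ TotallyDisconnectedSpace Q)
    (h15 : EdgeLikeIncidenceHolds Ω)
    (hbr : ∀ ⦃Q : Type u⦄ [Group Q] [TopologicalSpace Q] [IsTopologicalGroup Q] (G : PSCDatum Q),
      Ω.IsOfPSCType G → ∀ e : G.graph.N, ∃ (v₁ v₂ : G.graph.V) (γ₁ γ₂ : ConjAct Q),
        G.graph.nodeEnds e = s(v₁, v₂) ∧ γ₁ • G.nodeGp e ≤ G.vertGp v₁ ∧
          γ₂ • G.nodeGp e ≤ G.vertGp v₂ ∧ γ₁⁻¹ • G.vertGp v₁ ≠ γ₂⁻¹ • G.vertGp v₂) :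
    GraphicIffEdgeLikeVerticialHolds Ω :=
  graphicIffEdgeLikeVerticialHolds_of_incidence Ω
    (openInterDeterminesComponentHolds_of_separating Ω hsep hprof) h15 hbr

end Origin

end PSCDatum

end Literature.AnabelianGeometry.SemiGraphs

end
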